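import Mathlib
import HarnessLib
import Summits.HubbardSuperconductivity.HubbardSuperconductivity.Theorems.KLProgrammeH10TwoPointLimitSymbolProductSampled

/-!
# Route `KLProgramme` — engine support, route (L2) symbol layer: the space-direction second differences of a sampled symbol whose
# band is PERIODIC — the zone hypothesis on the symbol, not on the band

Cell `gate-hubbard-kl`, seat p4 (C5a lead), g6; companion of `KLProgrammeH10TwoPointLimitSymbolProductSampled.lean`.  There the vanishing of
the sampled symbol near the zone boundary was derived from a hypothesis `|p_j| ≥ π − zm ⇒ |e(p)| > Λ` on the band, which a PERIODIC band
(the frame's `e_K`) cannot satisfy on all of `ℝ²`.  This file proves the variant the frame instance consumes: the same pointwise bound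
**`norm_fwdDiff_two_space_sampledSymbol_le'`** with the zone hypothesis on the continuum symbol (`Φ(k₀, p) = 0` whenever some `|p_j| ≥ π − zm`,
arranged by a smooth square cutoff inside the angular factor — invisible on the shell) and with the line bounds of the angular factor required
only on the enlarged square `|p_i| ≤ π + zm`.  Everything is proved; no definitions, no named facts. [folklore]
-/

noncomputable section

namespace Summit.HubbardSuperconductivity.HubbardSuperconductivity.Theorems.TorusFourierL2

set_option linter.dupNamespace false -- summit = problem name (single-conjunct summit), D-0017

open Set Finset Filter Topology Literature.Probability.LatticeModels Literature.Analysis.Calculus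
open scoped Real

variable {P L : ℕ} [NeZero P] [NeZero L]

/-- **Space direction, pointwise, for a symbol vanishing near the zone boundary** (the form a PERIODIC band needs): as
`norm_fwdDiff_two_space_sampledSymbol_le`, but the zone hypothesis is put on `Φ` itself (`Φ(k₀, p) = 0` as soon as some `|p_j| ≥ π − zm`;
for a periodic band this is arranged by a smooth square cutoff inside `Z`, invisible on the shell), and the line bounds of `Z` are only
required at points of the enlarged square `|p_i| ≤ π + zm` (where the segments through the samples live); `τ = τ₀ + K₂(ρ + 2‖w‖)‖w‖`.
[cite: BenfattoGiulianiMastropietro2006, §2.5 Lemma 2.2 (2.53)–(2.55)] -/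
theorem norm_fwdDiff_two_space_sampledSymbol_le' {G : ℝ → ℝ} (hG : ContDiff ℝ 2 G) {Λ g₀ g₁ g₂ : ℝ} (hΛ : 0 < Λ)
    (hg₀ : 0 ≤ g₀) (hg₁ : 0 ≤ g₁) (hg₂ : 0 ≤ g₂) (hG0 : ∀ u, |G u| ≤ g₀) (hG1 : ∀ u, |deriv G u| ≤ g₁ / Λ ^ 2)
    (hG2 : ∀ u, |iteratedDeriv 2 G u| ≤ g₂ / Λ ^ 4) (hGv : ∀ u, Λ ^ 2 < u → G u = 0)
    {e : (Fin 2 → ℝ) → ℝ} (he : ContDiff ℝ 2 e) {K₂ : ℝ} (hK₂ : ∀ p, ‖iteratedFDeriv ℝ 2 e p‖ ≤ K₂)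
    {Z : (Fin 2 → ℝ) → ℝ} (hZ : ContDiff ℝ 2 Z) {z₀ z₁ z₂ : ℝ} (hz₀ : 0 ≤ z₀) (hz₁ : 0 ≤ z₁) (hz₂ : 0 ≤ z₂)
    (hZ0 : ∀ p, |Z p| ≤ z₀) (w : Fin 2 → ℝ)
    {zm : ℝ}
    (hZ1 : ∀ (p₀ : Fin 2 → ℝ) (s : ℝ), (∀ i, |(p₀ + s • w) i| ≤ π + zm) → |e (p₀ + s • w)| ≤ Λ →
      |deriv (fun s : ℝ => Z (p₀ + s • w)) s| ≤ z₁)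
    (hZ2 : ∀ (p₀ : Fin 2 → ℝ) (s : ℝ), (∀ i, |(p₀ + s • w) i| ≤ π + zm) → |e (p₀ + s • w)| ≤ Λ →
      |iteratedDeriv 2 (fun s : ℝ => Z (p₀ + s • w)) s| ≤ z₂)
    {pF : Fin 2 → ℝ} {ρ τ₀ : ℝ} (hρ : 0 ≤ ρ) (hτ₀ : |fderiv ℝ e pF w| ≤ τ₀)
    (hcell : ∀ p : Fin 2 → ℝ, (∀ i, |p i| ≤ π + zm) → |e p| ≤ Λ → Z p ≠ 0 → ‖p - pF‖ ≤ ρ)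
    (Φ : ℝ × (Fin 2 → ℝ) → ℂ) (hΦ : ∀ k₀ p, Φ (k₀, p) = ((G (k₀ ^ 2 + e p ^ 2) * Z p : ℝ) : ℂ)) (a₀ h₀ hx : ℝ)
    (u : Fin 2 → ℤ) (hw : w = fun j => hx * (u j : ℝ)) (hu : ∀ j, 2 * |hx| * |(u j : ℝ)| ≤ zm)
    (hzoneΦ : ∀ (k₀ : ℝ) (p : Fin 2 → ℝ), (∃ j, π - zm ≤ |p j|) → Φ (k₀, p) = 0) (hxL : |hx| * L = 2 * π)
    (Gs : TorusSite 1 P × TorusSite 2 L → ℂ)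
    (hGs : ∀ q, Gs q = Φ (a₀ + h₀ * (((q.1 0).val : ℕ) : ℝ), fun j => hx * (((q.2 j).valMinAbs : ℤ) : ℝ)))
    (q : TorusSite 1 P × TorusSite 2 L) :
    ‖((fwdDiff ((0 : TorusSite 1 P), (fun j => ((u j : ℤ) : ZMod L))))^[2] Gs) q‖ ≤
      ((4 * g₂ + 2 * g₁) * (τ₀ + K₂ * (ρ + 2 * ‖w‖) * ‖w‖) ^ 2 / Λ ^ 2 + 2 * g₁ * (K₂ * ‖w‖ ^ 2) / Λ) * z₀ +
        4 * g₁ * (τ₀ + K₂ * (ρ + 2 * ‖w‖) * ‖w‖) / Λ * z₁ + g₀ * z₂ := by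
  have hK0 : 0 ≤ K₂ := le_trans (norm_nonneg _) (hK₂ pF)
  have hτ0' : 0 ≤ τ₀ := le_trans (abs_nonneg _) hτ₀
  set τ : ℝ := τ₀ + K₂ * (ρ + 2 * ‖w‖) * ‖w‖ with hτ
  have hτpos : 0 ≤ τ := by positivity
  have hRHS : 0 ≤ ((4 * g₂ + 2 * g₁) * τ ^ 2 / Λ ^ 2 + 2 * g₁ * (K₂ * ‖w‖ ^ 2) / Λ) * z₀ + 4 * g₁ * τ / Λ * z₁ + g₀ * z₂ := by
    positivity
  -- the zone: `Φ(k₀, hₓ m) = 0` whenever `2|m_j| + 4|u_j| ≥ L`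
  have hL : (0 : ℝ) < L := Nat.cast_pos.2 (Nat.pos_of_ne_zero (NeZero.ne L))
  have hzone' : ∀ (k₀ : ℝ) (m : Fin 2 → ℤ), (∃ j, (L : ℤ) ≤ 2 * |m j| + 2 * (2 : ℕ) * |u j|) →
      Φ (k₀, fun j => hx * (m j : ℝ)) = 0 := by
    intro k₀ m ⟨j, hj⟩
    have hj' : (L : ℝ) ≤ 2 * |(m j : ℝ)| + 4 * |(u j : ℝ)| := by
      have := hj; push_cast at this ⊢; rw [← Int.cast_abs, ← Int.cast_abs]; exact_mod_cast (by linarith : (L:ℤ) ≤ 2*|m j| + 4*|u j|)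
    have hpj : π - zm ≤ |hx * (m j : ℝ)| := by
      rw [abs_mul]
      have h1 : |hx| * L ≤ |hx| * (2 * |(m j : ℝ)| + 4 * |(u j : ℝ)|) := mul_le_mul_of_nonneg_left hj' (abs_nonneg _)
      have h2 := hu j
      nlinarith [abs_nonneg hx, abs_nonneg (m j : ℝ)]
    exact hzoneΦ k₀ (fun j => hx * (m j : ℝ)) ⟨j, hpj⟩
  -- trivial case: all three samples vanish
  by_cases hall : ∀ t : ℕ, t ≤ 2 → Gs (q + t • ((0 : TorusSite 1 P), fun j => ((u j : ℤ) : ZMod L))) = 0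
  · rw [fwdDiff_iter_eq_zero_of_forall Gs _ 2 q hall, norm_zero]
    exact hRHS
  push Not at hall
  obtain ⟨t, ht, hne⟩ := hall
  -- the sample point and the straight segment
  set k₀ : ℝ := a₀ + h₀ * (((q.1 0).val : ℕ) : ℝ) with hk₀
  set k : Fin 2 → ℝ := fun j => hx * (((q.2 j).valMinAbs : ℤ) : ℝ) with hk
  have hpt : Φ (k₀, k + (t : ℝ) • w) ≠ 0 := by
    rw [hw]; exact sampledSymbol_shift_ne_zero Φ a₀ h₀ hx u hzone' Gs hGs q ht hne
  rw [hΦ] at hpt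
  obtain ⟨-, het, hZt⟩ := symbol_support hΛ hGv e Z (fun h0 => hpt (by rw [h0]; simp))
  have hsq : ∀ s : ℝ, |s| ≤ 2 → ∀ i, |(k + s • w) i| ≤ π + zm := by
    intro s hs2 i
    have h1 : |k i| ≤ π := abs_sample_le_pi hxL q.2 i
    have h2 : |(s • w) i| ≤ zm := by
      rw [Pi.smul_apply, smul_eq_mul, abs_mul, hw]
      calc |s| * |hx * (u i : ℝ)| ≤ 2 * |hx * (u i : ℝ)| := mul_le_mul_of_nonneg_right hs2 (abs_nonneg _)
        _ = 2 * |hx| * |(u i : ℝ)| := by rw [abs_mul]; ring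
        _ ≤ zm := hu i
    calc |(k + s • w) i| = |k i + (s • w) i| := rfl
      _ ≤ |k i| + |(s • w) i| := abs_add_le _ _
      _ ≤ π + zm := add_le_add h1 h2
  have ht2 : |(t : ℝ)| ≤ 2 := by rw [abs_of_nonneg (Nat.cast_nonneg t)]; exact_mod_cast ht
  have hnear_t : ‖k + (t : ℝ) • w - pF‖ ≤ ρ := hcell _ (hsq (t : ℝ) ht2) het hZt
  -- every point of the segment `s ∈ [0, 2]` is within `ρ + 2‖w‖` of `p_F`
  have hnear : ∀ s ∈ Set.Icc (0 : ℝ) 2, ‖k + s • w - pF‖ ≤ ρ + 2 * ‖w‖ := by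
    intro s hs
    have hts : |s - (t : ℝ)| ≤ 2 := by
      have ht' : (t : ℝ) ≤ 2 := by exact_mod_cast ht
      have ht0 : (0 : ℝ) ≤ t := Nat.cast_nonneg t
      rw [abs_le]; constructor <;> linarith [hs.1, hs.2]
    calc ‖k + s • w - pF‖ = ‖(k + (t : ℝ) • w - pF) + (s - (t : ℝ)) • w‖ := by congr 1; rw [sub_smul]; abel
      _ ≤ ‖k + (t : ℝ) • w - pF‖ + ‖(s - (t : ℝ)) • w‖ := norm_add_le _ _
      _ ≤ ρ + 2 * ‖w‖ := by
          rw [norm_smul, Real.norm_eq_abs]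
          exact add_le_add hnear_t (mul_le_mul_of_nonneg_right hts (norm_nonneg _))
  -- the line function
  have hline : (fun s : ℝ => Φ (((k₀, k) : ℝ × (Fin 2 → ℝ)) + s • (((0 : ℝ), w) : ℝ × (Fin 2 → ℝ)))) =
      fun s => (((G (e (k + s • w) ^ 2 + k₀ ^ 2) * Z (k + s • w) : ℝ)) : ℂ) := by
    funext s; rw [spaceLine_apply, hΦ]; push_cast; ring
  have hZl : ContDiff ℝ 2 fun s : ℝ => Z (k + s • w) := hZ.comp (contDiff_const.add (contDiff_id.smul contDiff_const))
  have hreal : ContDiff ℝ 2 fun s : ℝ => G (e (k + s • w) ^ 2 + k₀ ^ 2) * Z (k + s • w) :=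
    contDiff_two_radialComp_mul hG (contDiff_two_line he k w) hZl _
  have hC : ContDiff ℝ 2 fun s : ℝ => Φ (((k₀, k) : ℝ × (Fin 2 → ℝ)) + s • (((0 : ℝ), w) : ℝ × (Fin 2 → ℝ))) := by
    rw [hline]; exact Complex.ofRealCLM.contDiff.comp hreal
  have hstep : (((0 : ℝ), w) : ℝ × (Fin 2 → ℝ)) = ((0 : ℝ), fun j => hx * (u j : ℝ)) := by rw [hw]
  have hmain : ∀ s ∈ Set.Icc (0 : ℝ) 2, ‖iteratedDeriv 2 (fun s : ℝ =>
      Φ (((k₀, k) : ℝ × (Fin 2 → ℝ)) + s • (((0 : ℝ), w) : ℝ × (Fin 2 → ℝ)))) s‖ ≤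
      ((4 * g₂ + 2 * g₁) * τ ^ 2 / Λ ^ 2 + 2 * g₁ * (K₂ * ‖w‖ ^ 2) / Λ) * z₀ + 4 * g₁ * τ / Λ * z₁ + g₀ * z₂ := by
    intro s hs
    rw [hline, norm_iteratedDeriv_ofReal_comp hreal]
    by_cases hsupp : Λ ^ 2 < e (k + s • w) ^ 2 + k₀ ^ 2
    · rw [(radialComp_mul_eq_zero_of_lt hG (contDiff_two_line he k w) hZl hGv (k₀ ^ 2) hsupp).2.2, abs_zero]
      exact hRHS
    · push Not at hsupp
      have hes : |e (k + s • w)| ≤ Λ := abs_le_of_sq_add_le (sq_nonneg k₀) hΛ.le hsupp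
      have h := abs_iteratedDeriv_two_symbol_spaceLine_le he hK₂ hG hZl hΛ hg₁ hg₂ hG0 hG1 hG2 hGv (sq_nonneg k₀) k w s
      have hdir : |fderiv ℝ e (k + s • w) w| ≤ τ := by
        have h1 := abs_fderiv_apply_le_of_near he hK₂ pF (k + s • w) w
        have h2 : K₂ * ‖k + s • w - pF‖ * ‖w‖ ≤ K₂ * (ρ + 2 * ‖w‖) * ‖w‖ :=
          mul_le_mul_of_nonneg_right (mul_le_mul_of_nonneg_left (hnear s hs) hK0) (norm_nonneg _)
        rw [hτ]; linarith
      have hsqd : (fderiv ℝ e (k + s • w) w) ^ 2 ≤ τ ^ 2 := by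
        rw [← sq_abs]; exact pow_le_pow_left₀ (abs_nonneg _) hdir 2
      have hs2 : |s| ≤ 2 := by rw [abs_of_nonneg hs.1]; exact hs.2
      have hZ1s := hZ1 k s (hsq s hs2) hes
      have hZ2s := hZ2 k s (hsq s hs2) hes
      have hZ0s := hZ0 (k + s • w)
      calc _ ≤ ((4 * g₂ + 2 * g₁) * (fderiv ℝ e (k + s • w) w) ^ 2 / Λ ^ 2 + 2 * g₁ * (K₂ * ‖w‖ ^ 2) / Λ) * |Z (k + s • w)| +
            4 * g₁ * |fderiv ℝ e (k + s • w) w| / Λ * |deriv (fun s : ℝ => Z (k + s • w)) s| +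
            g₀ * |iteratedDeriv 2 (fun s : ℝ => Z (k + s • w)) s| := h
        _ ≤ ((4 * g₂ + 2 * g₁) * τ ^ 2 / Λ ^ 2 + 2 * g₁ * (K₂ * ‖w‖ ^ 2) / Λ) * z₀ + 4 * g₁ * τ / Λ * z₁ + g₀ * z₂ := by
            gcongr
  rw [hstep] at hC hmain
  exact norm_fwdDiff_iter_space_apply_le Φ a₀ h₀ hx 2 Gs hGs u hzone' q hC hmain


end Summit.HubbardSuperconductivity.HubbardSuperconductivity.Theorems.TorusFourierL2

end
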